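import Mathlib

/-!
# The resolvent of a compact self-adjoint operator is meromorphic off `0`

Support file (functional analysis) for the meromorphic continuation of the Eisenstein series of a
general finite volume Fuchsian group (`Literature/NumberTheory/Automorphic/FuchsianEisensteinContinuation*`,
towards `Iwaniec2002_eq_12_5` / `Iwaniec2002_thm_12_1`), where Colin de Verdière's idea — recover
`E_𝔞(z, s)` from the resolvent of a self-adjoint operator with discrete spectrum on the pseudo-cusp
forms — is run with the compact compressions `P_Y T_k P_Y` of the invariant integral operators
(`FuchsianPseudoCuspForms`). Everything here is standard Hilbert-space operator theory, PROVED from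
Mathlib (spectral theory of compact operators: `IsCompactOperator.hasEigenvalue_or_mem_resolventSet`,
`ContinuousLinearMap.finite_dimensional_eigenspace`; analyticity of the resolvent:
`spectrum.hasDerivAt_resolvent_const_left`; meromorphic functions: `MeromorphicAt`,
`MeromorphicOn.meromorphicOrderAt_ne_top_of_isPreconnected`); nothing is vendored.

For a bounded operator `T` on a complex Hilbert space `E`, `R(μ) = resolvent T μ = (μ - T)⁻¹`
(Mathlib's `resolvent`, `0` off the resolvent set):

1. (§1) algebra of the resolvent (`sub_apply_resolvent`, `resolvent_apply_sub`,
   `eq_resolvent_of_sub_eq` — uniqueness of solutions of `μ v - T v = x` —, two-sided inverses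
   `mem_resolventSet_and_resolvent_eq_of_inverse`), **analyticity** on the resolvent set
   (`analyticOnNhd_resolvent`) and of families `s ↦ R(c(s)) a(s)` (`analyticAt_resolvent_apply`;
   `AnalyticAt.clm_apply_analyticAt`).
2. (§2) self-adjoint `T`: an eigenvector with non-real eigenvalue vanishes
   (`eq_zero_of_apply_eq_smul_of_im_ne_zero`), non-real numbers are in the resolvent set
   (`mem_resolventSet_of_im_ne_zero`, from `IsSelfAdjoint.im_eq_zero_of_mem_spectrum`).
3. (§3) compact self-adjoint `T`, `μ₀ ≠ 0`: the eigenprojection `P = eigenProj` onto the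
   (finite-dimensional) eigenspace `V_{μ₀}`, commuting with `T`; the **deflated operator**
   `S = deflate = T - μ₀ P` is compact and `μ₀` is NOT an eigenvalue of `S`, hence (Fredholm
   alternative) `μ₀ ∈ ρ(S)`; for `μ ∈ ρ(S)`, `μ ≠ μ₀`:
   `μ ∈ ρ(T)` and **`R_T(μ) = R_S(μ)(1 - P) + (μ - μ₀)⁻¹ P`** (`mem_resolventSet_and_resolvent_eq`).
   Consequences: **the non-zero spectrum is discrete** (`eventually_mem_resolventSet`: a punctured
   neighbourhood of `μ₀` lies in `ρ(T)`) and **the resolvent is meromorphic at `μ₀`**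
   (`meromorphicAt_resolvent`, operator-valued, at most a simple pole with residue `P`).
4. (§4) meromorphic families: `MeromorphicAt.clm_apply_analyticAt`, `meromorphicAt_resolvent_apply`,
   and `meromorphicAt_resolvent_comp`: **`s ↦ R_T(c(s)) a(s)` is meromorphic** wherever the analytic
   scalar `c` does not vanish and `a` is analytic (vector-valued).
5. (§5) the identity principle for meromorphic vector-valued functions on a preconnected set, in
   the forms used downstream (`MeromorphicOn.eventually_eq_zero_of_eventually_eq_zero`,
   `MeromorphicOn.eq_zero_of_eventually_eq_zero`, `MeromorphicOn.eq_of_eventually_eq`,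
   `MeromorphicOn.eventually_eq_of_eventually_eq`).

## References
* F. Riesz, B. Sz.-Nagy, *Functional Analysis* (1955), §§77–80, 93 (compact symmetric operators,
  the resolvent near an isolated eigenvalue).
* [Colindeverdiere1983] Y. Colin de Verdière, *Pseudo-laplaciens II*, Ann. Inst. Fourier 33 (1983)
  87–113 (the use made of a compact-resolvent operator for Eisenstein series).
* [Iwaniec2002] H. Iwaniec, *Spectral Methods of Automorphic Forms*, 2nd ed., GSM 53, AMS 2002,
  Appendix A.3–A.4, PDF pp. 135–138 (compact operators, resolvents).
-/

noncomputable section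

namespace Literature.Analysis.OperatorTheory

namespace CompactResolvent

open Module Module.End Filter Topology Submodule
open scoped InnerProductSpace ComplexConjugate

variable {E : Type*} [NormedAddCommGroup E] [InnerProductSpace ℂ E]

/-! ## 1. The resolvent of a bounded operator: algebra and analyticity -/

section Resolvent

omit [InnerProductSpace ℂ E] in
/-- **Analyticity of `z ↦ G(z) a(z)`** for analytic operator-valued `G` and vector-valued `a`
(evaluation is a continuous bilinear map). [folklore] -/
theorem _root_.AnalyticAt.clm_apply_analyticAt {E' : Type*} [NormedAddCommGroup E'] [NormedSpace ℂ E']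
    {G : ℂ → (E' →L[ℂ] E')} {a : ℂ → E'} {s : ℂ}
    (hG : AnalyticAt ℂ G s) (ha : AnalyticAt ℂ a s) : AnalyticAt ℂ (fun z => G z (a z)) s := by
  have hB := (ContinuousLinearMap.id ℂ (E' →L[ℂ] E')).analyticAt_bilinear (G s, a s)
  exact hB.comp₂ hG ha

variable (T : E →L[ℂ] E)

/-- `(μ - T)` as an operator. [folklore] -/
theorem algebraMap_sub_apply (μ : ℂ) (x : E) :
    (algebraMap ℂ (E →L[ℂ] E) μ - T) x = μ • x - T x := by
  simp [Algebra.algebraMap_eq_smul_one]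

variable {T}

/-- **The resolvent solves `(μ - T) v = x`**: for `μ` in the resolvent set,
`μ R(μ)x - T R(μ)x = x`. [folklore] -/
theorem sub_apply_resolvent {μ : ℂ} (hμ : μ ∈ resolventSet ℂ T) (x : E) :
    μ • resolvent T μ x - T (resolvent T μ x) = x := by
  have h1 : (algebraMap ℂ (E →L[ℂ] E) μ - T) * resolvent T μ = 1 := by
    rw [spectrum.resolvent_eq hμ]; exact hμ.mul_val_inv
  have h2 := congrArg (fun S : E →L[ℂ] E => S x) h1
  simp only [mul_apply_eq_comp, one_apply_eq_self, algebraMap_sub_apply] at h2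
  exact h2

/-- … and `R(μ)(μ v - T v) = v`. [folklore] -/
theorem resolvent_apply_sub {μ : ℂ} (hμ : μ ∈ resolventSet ℂ T) (v : E) :
    resolvent T μ (μ • v - T v) = v := by
  have h1 : resolvent T μ * (algebraMap ℂ (E →L[ℂ] E) μ - T) = 1 := by
    rw [spectrum.resolvent_eq hμ]; exact hμ.val_inv_mul
  have h2 := congrArg (fun S : E →L[ℂ] E => S v) h1
  simp only [mul_apply_eq_comp, one_apply_eq_self, algebraMap_sub_apply] at h2
  exact h2

/-- **Uniqueness**: if `μ v - T v = x` with `μ` in the resolvent set then `v = R(μ) x`. [folklore] -/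
theorem eq_resolvent_of_sub_eq {μ : ℂ} (hμ : μ ∈ resolventSet ℂ T) {v x : E} (h : μ • v - T v = x) :
    v = resolvent T μ x := by
  rw [← h, resolvent_apply_sub hμ]

/-- A two-sided inverse exhibits membership in the resolvent set and computes the resolvent. [folklore] -/
theorem mem_resolventSet_and_resolvent_eq_of_inverse {μ : ℂ} {R : E →L[ℂ] E}
    (h₁ : (algebraMap ℂ (E →L[ℂ] E) μ - T) * R = 1) (h₂ : R * (algebraMap ℂ (E →L[ℂ] E) μ - T) = 1) :
    μ ∈ resolventSet ℂ T ∧ resolvent T μ = R := by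
  have hμ : μ ∈ resolventSet ℂ T := spectrum.mem_resolventSet_of_left_right_inverse h₁ h₂
  refine ⟨hμ, ?_⟩
  rw [spectrum.resolvent_eq hμ]
  have : (hμ.unit⁻¹ : (E →L[ℂ] E)ˣ) = hμ.unit⁻¹ * ((algebraMap ℂ (E →L[ℂ] E) μ - T) * R) := by rw [h₁, mul_one]
  rw [this, ← mul_assoc, IsUnit.val_inv_mul, one_mul]

variable [CompleteSpace E]

/-- **The resolvent is analytic on the resolvent set** (operator-valued). [folklore] -/
theorem analyticOnNhd_resolvent : AnalyticOnNhd ℂ (resolvent T) (resolventSet ℂ T) := by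
  have hdiff : DifferentiableOn ℂ (resolvent T) (resolventSet ℂ T) := fun μ hμ =>
    (spectrum.hasDerivAt_resolvent_const_left hμ).differentiableAt.differentiableWithinAt
  exact hdiff.analyticOnNhd (spectrum.isOpen_resolventSet T)

/-- **`s ↦ R(c(s)) a(s)` is analytic** where `c(s)` stays in the resolvent set and `a` is analytic. [folklore] -/
theorem analyticAt_resolvent_apply {c : ℂ → ℂ} {a : ℂ → E} {s : ℂ} (hc : AnalyticAt ℂ c s)
    (ha : AnalyticAt ℂ a s) (hs : c s ∈ resolventSet ℂ T) :
    AnalyticAt ℂ (fun z => resolvent T (c z) (a z)) s := by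
  have h1 : AnalyticAt ℂ (resolvent T ∘ c) s := (analyticOnNhd_resolvent (c s) hs).comp hc
  exact h1.clm_apply_analyticAt ha

end Resolvent

/-! ## 2. Self-adjoint operators: real eigenvalues, non-real numbers are regular -/

section SelfAdjoint

variable [CompleteSpace E] {T : E →L[ℂ] E}

/-- **An eigenvector of a self-adjoint operator with a non-real eigenvalue vanishes.** [folklore] -/
theorem eq_zero_of_apply_eq_smul_of_im_ne_zero (hT : IsSelfAdjoint T) {μ : ℂ} (hμ : μ.im ≠ 0) {v : E}
    (h : T v = μ • v) : v = 0 := by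
  have hsymm : (T : E →ₗ[ℂ] E).IsSymmetric := (ContinuousLinearMap.isSelfAdjoint_iff_isSymmetric).mp hT
  have h1 : ⟪T v, v⟫_ℂ = conj μ * ⟪v, v⟫_ℂ := by rw [h, inner_smul_left]
  have h2 : ⟪T v, v⟫_ℂ = μ * ⟪v, v⟫_ℂ := by
    rw [show ⟪T v, v⟫_ℂ = ⟪v, T v⟫_ℂ from hsymm v v, h, inner_smul_right]
  have h3 : (conj μ - μ) * ⟪v, v⟫_ℂ = 0 := by rw [sub_mul, ← h1, ← h2, sub_self]
  rcases mul_eq_zero.mp h3 with h4 | h4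
  · exfalso
    apply hμ
    have := congrArg Complex.im h4
    simp only [Complex.sub_im, Complex.conj_im, Complex.zero_im] at this
    linarith
  · exact inner_self_eq_zero.mp h4

/-- **Non-real numbers lie in the resolvent set of a self-adjoint operator.** [folklore] -/
theorem mem_resolventSet_of_im_ne_zero (hT : IsSelfAdjoint T) {μ : ℂ} (hμ : μ.im ≠ 0) :
    μ ∈ resolventSet ℂ T := by
  by_contra hcontra
  have hmem : μ ∈ spectrum ℂ T := hcontra
  exact hμ (hT.im_eq_zero_of_mem_spectrum hmem)

/-- Eigenvalues of a self-adjoint operator are real. [folklore] -/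
theorem im_eq_zero_of_hasEigenvalue (hT : IsSelfAdjoint T) {μ : ℂ} (hμ : HasEigenvalue (T : End ℂ E) μ) :
    μ.im = 0 := by
  by_contra hne
  obtain ⟨v, hv, hv0⟩ := hμ.exists_hasEigenvector
  exact hv0 (eq_zero_of_apply_eq_smul_of_im_ne_zero hT hne (mem_eigenspace_iff.mp hv))

end SelfAdjoint

/-! ## 3. Compact self-adjoint operators: isolated eigenvalues and the meromorphic resolvent -/

section Compact

variable [CompleteSpace E] {T : E →L[ℂ] E}

omit [CompleteSpace E] in
/-- The eigenspace of a bounded operator is invariant: `T(V_μ) ⊆ V_μ`. [folklore] -/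
theorem apply_mem_eigenspace {μ : ℂ} {v : E} (hv : v ∈ eigenspace (T : End ℂ E) μ) :
    T v ∈ eigenspace (T : End ℂ E) μ := by
  rw [mem_eigenspace_iff] at hv ⊢
  have hv' : T v = μ • v := hv
  change T (T v) = μ • T v
  rw [hv', map_smul, hv']

/-- For a self-adjoint operator the orthogonal complement of an eigenspace is invariant. [folklore] -/
theorem apply_mem_eigenspace_orthogonal (hT : IsSelfAdjoint T) {μ : ℂ} {w : E}
    (hw : w ∈ (eigenspace (T : End ℂ E) μ)ᗮ) : T w ∈ (eigenspace (T : End ℂ E) μ)ᗮ := by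
  have hsymm : (T : E →ₗ[ℂ] E).IsSymmetric := (ContinuousLinearMap.isSelfAdjoint_iff_isSymmetric).mp hT
  rw [mem_orthogonal] at hw ⊢
  intro u hu
  rw [show ⟪u, T w⟫_ℂ = ⟪T u, w⟫_ℂ from (hsymm u w).symm]
  exact hw _ (apply_mem_eigenspace hu)

/-- The eigenspace of a compact operator for `μ₀ ≠ 0` is finite-dimensional, hence admits an
orthogonal projection. [folklore] -/
theorem hasOrthogonalProjection_eigenspace (_hc : IsCompactOperator T) {μ₀ : ℂ} (_hμ₀ : μ₀ ≠ 0) :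
    (eigenspace (T : End ℂ E) μ₀).HasOrthogonalProjection := by
  infer_instance

/-- **The self-adjoint projection `P` onto the eigenspace `V_{μ₀}`** of a compact operator (`μ₀ ≠ 0`).
[folklore] -/
def eigenProj (hc : IsCompactOperator T) {μ₀ : ℂ} (hμ₀ : μ₀ ≠ 0) : E →L[ℂ] E :=
  haveI := hasOrthogonalProjection_eigenspace hc hμ₀
  (eigenspace (T : End ℂ E) μ₀).starProjection

/-- The **deflated operator** `S = T - μ₀ P`, with the eigenvalue `μ₀` removed. [folklore] -/
def deflate (hc : IsCompactOperator T) {μ₀ : ℂ} (hμ₀ : μ₀ ≠ 0) : E →L[ℂ] E :=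
  T - μ₀ • eigenProj hc hμ₀

variable (hT : IsSelfAdjoint T) (hc : IsCompactOperator T) {μ₀ : ℂ} (hμ₀ : μ₀ ≠ 0)

/-- `P x ∈ V_{μ₀}`. [folklore] -/
theorem eigenProj_mem (x : E) : eigenProj hc hμ₀ x ∈ eigenspace (T : End ℂ E) μ₀ := by
  haveI := hasOrthogonalProjection_eigenspace hc hμ₀
  exact starProjection_apply_mem _ x

/-- `P P = P`. [folklore] -/
theorem eigenProj_idem (x : E) : eigenProj hc hμ₀ (eigenProj hc hμ₀ x) = eigenProj hc hμ₀ x := by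
  haveI := hasOrthogonalProjection_eigenspace hc hμ₀
  exact (eigenspace (T : End ℂ E) μ₀).starProjection_eq_self_iff.mpr (eigenProj_mem hc hμ₀ x)

/-- `x - P x ∈ V_{μ₀}ᗮ`. [folklore] -/
theorem sub_eigenProj_mem_orthogonal (x : E) : x - eigenProj hc hμ₀ x ∈ (eigenspace (T : End ℂ E) μ₀)ᗮ := by
  haveI := hasOrthogonalProjection_eigenspace hc hμ₀
  exact (eigenspace (T : End ℂ E) μ₀).sub_starProjection_mem_orthogonal x

/-- `P` kills `V_{μ₀}ᗮ`. [folklore] -/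
theorem eigenProj_eq_zero_of_mem_orthogonal {w : E} (hw : w ∈ (eigenspace (T : End ℂ E) μ₀)ᗮ) :
    eigenProj hc hμ₀ w = 0 := by
  haveI := hasOrthogonalProjection_eigenspace hc hμ₀
  exact (eigenspace (T : End ℂ E) μ₀).starProjection_apply_eq_zero_iff.mpr hw

/-- `T P = μ₀ P`. [folklore] -/
theorem apply_eigenProj (x : E) : T (eigenProj hc hμ₀ x) = μ₀ • eigenProj hc hμ₀ x :=
  mem_eigenspace_iff.mp (eigenProj_mem hc hμ₀ x)

include hT in
/-- **`P` commutes with `T`** (both `V_{μ₀}` and its orthogonal complement are invariant). [folklore] -/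
theorem eigenProj_apply_comm (x : E) : eigenProj hc hμ₀ (T x) = T (eigenProj hc hμ₀ x) := by
  have hx := sub_eigenProj_mem_orthogonal hc hμ₀ x
  have h1 : T x = T (eigenProj hc hμ₀ x) + T (x - eigenProj hc hμ₀ x) := by
    rw [← map_add, add_sub_cancel]
  rw [h1, map_add]
  have h2 : eigenProj hc hμ₀ (T (eigenProj hc hμ₀ x)) = T (eigenProj hc hμ₀ x) := by
    haveI := hasOrthogonalProjection_eigenspace hc hμ₀
    exact (eigenspace (T : End ℂ E) μ₀).starProjection_eq_self_iff.mpr (apply_mem_eigenspace (eigenProj_mem hc hμ₀ x))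
  have h3 : eigenProj hc hμ₀ (T (x - eigenProj hc hμ₀ x)) = 0 :=
    eigenProj_eq_zero_of_mem_orthogonal hc hμ₀ (apply_mem_eigenspace_orthogonal hT hx)
  rw [h2, h3, add_zero]

/-- `T x = S x + μ₀ P x`. [folklore] -/
theorem apply_eq_deflate_add (x : E) : T x = deflate hc hμ₀ x + μ₀ • eigenProj hc hμ₀ x := by
  simp only [deflate, _root_.sub_apply, _root_.smul_apply, sub_add_cancel]

/-- `S P = 0`. [folklore] -/
theorem deflate_eigenProj (x : E) : deflate hc hμ₀ (eigenProj hc hμ₀ x) = 0 := by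
  simp only [deflate, _root_.sub_apply, _root_.smul_apply, eigenProj_idem, apply_eigenProj, sub_self]

include hT in
/-- `S` commutes with `P`. [folklore] -/
theorem eigenProj_deflate_comm (x : E) :
    eigenProj hc hμ₀ (deflate hc hμ₀ x) = deflate hc hμ₀ (eigenProj hc hμ₀ x) := by
  rw [deflate_eigenProj]
  simp only [deflate, _root_.sub_apply, _root_.smul_apply, map_sub, map_smul, eigenProj_apply_comm hT hc hμ₀,
    apply_eigenProj, eigenProj_idem, sub_self]

/-- **`S` is compact** (`P` has finite rank). [folklore] -/
theorem isCompactOperator_deflate : IsCompactOperator (deflate hc hμ₀) := by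
  haveI := hasOrthogonalProjection_eigenspace hc hμ₀
  haveI : FiniteDimensional ℂ (eigenspace (T : End ℂ E) μ₀) := T.finite_dimensional_eigenspace hc μ₀ hμ₀
  have hP : IsCompactOperator (eigenProj hc hμ₀) := by
    have hid : IsCompactOperator (_root_.id : eigenspace (T : End ℂ E) μ₀ → eigenspace (T : End ℂ E) μ₀) :=
      (isCompactOperator_id_iff_finiteDimensional (𝕜 := ℂ)).mpr inferInstance
    have h1 : IsCompactOperator ((ContinuousLinearMap.id ℂ (eigenspace (T : End ℂ E) μ₀)).comp
        (eigenspace (T : End ℂ E) μ₀).orthogonalProjectionOnto) := hid.comp_clm _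
    exact h1.clm_comp (eigenspace (T : End ℂ E) μ₀).subtypeL
  exact hc.sub (hP.smul μ₀)

include hT in
/-- **`μ₀` is not an eigenvalue of `S`.** [folklore] -/
theorem not_hasEigenvalue_deflate : ¬ HasEigenvalue (deflate hc hμ₀ : End ℂ E) μ₀ := by
  intro hev
  obtain ⟨w, hw, hw0⟩ := hev.exists_hasEigenvector
  have hSw : deflate hc hμ₀ w = μ₀ • w := mem_eigenspace_iff.mp hw
  -- facts about `P`, then generalise
  have hu : w - eigenProj hc hμ₀ w ∈ (eigenspace (T : End ℂ E) μ₀)ᗮ := sub_eigenProj_mem_orthogonal hc hμ₀ w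
  have hvV : eigenProj hc hμ₀ w ∈ eigenspace (T : End ℂ E) μ₀ := eigenProj_mem hc hμ₀ w
  have hTv : T (eigenProj hc hμ₀ w) = μ₀ • eigenProj hc hμ₀ w := apply_eigenProj hc hμ₀ w
  have hTS : ∀ x, T x = deflate hc hμ₀ x + μ₀ • eigenProj hc hμ₀ x := apply_eq_deflate_add hc hμ₀
  have hSP : deflate hc hμ₀ (eigenProj hc hμ₀ w) = 0 := deflate_eigenProj hc hμ₀ w
  generalize eigenProj hc hμ₀ w = v at *
  set u := w - v with hudef
  -- `S w = S u = T u - μ₀ P u`, and `P u = 0`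
  have e : w = v + u := by rw [hudef]; abel
  have hPu : eigenProj hc hμ₀ u = 0 := eigenProj_eq_zero_of_mem_orthogonal hc hμ₀ hu
  have hTu : T u = μ₀ • v + μ₀ • u := by
    have h1 : T u = deflate hc hμ₀ u + μ₀ • eigenProj hc hμ₀ u := hTS u
    rw [hPu, smul_zero, add_zero] at h1
    have h2 : deflate hc hμ₀ w = deflate hc hμ₀ v + deflate hc hμ₀ u := by rw [e, map_add]
    rw [hSP, zero_add, hSw] at h2
    rw [h1, ← h2, e, smul_add]
  -- the `V`-component of `T u ∈ Vᗮ` forces `v = 0`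
  have hTu_orth : T u ∈ (eigenspace (T : End ℂ E) μ₀)ᗮ := apply_mem_eigenspace_orthogonal hT hu
  have hv0 : v = 0 := by
    have h1 : μ₀ • v = T u - μ₀ • u := by rw [hTu]; abel
    have h2 : μ₀ • v ∈ (eigenspace (T : End ℂ E) μ₀)ᗮ := by
      rw [h1]; exact Submodule.sub_mem _ hTu_orth (Submodule.smul_mem _ _ hu)
    have h3 : μ₀ • v ∈ eigenspace (T : End ℂ E) μ₀ := Submodule.smul_mem _ _ hvV
    have h4 : μ₀ • v = 0 := by
      have hmem : μ₀ • v ∈ eigenspace (T : End ℂ E) μ₀ ⊓ (eigenspace (T : End ℂ E) μ₀)ᗮ := ⟨h3, h2⟩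
      rw [Submodule.inf_orthogonal_eq_bot] at hmem
      exact (Submodule.mem_bot ℂ).mp hmem
    exact (smul_eq_zero.mp h4).resolve_left hμ₀
  have huV : u ∈ eigenspace (T : End ℂ E) μ₀ := by
    rw [mem_eigenspace_iff]
    change T u = μ₀ • u
    rw [hTu, hv0, smul_zero, zero_add]
  have hu0 : u = 0 := by
    have hmem : u ∈ eigenspace (T : End ℂ E) μ₀ ⊓ (eigenspace (T : End ℂ E) μ₀)ᗮ := ⟨huV, hu⟩
    rw [Submodule.inf_orthogonal_eq_bot] at hmem
    exact (Submodule.mem_bot ℂ).mp hmem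
  apply hw0
  rw [e, hv0, hu0, add_zero]

include hT in
/-- **`μ₀` lies in the resolvent set of the deflated operator** (Fredholm alternative). [folklore] -/
theorem mem_resolventSet_deflate : μ₀ ∈ resolventSet ℂ (deflate hc hμ₀) :=
  ((isCompactOperator_deflate hc hμ₀).hasEigenvalue_or_mem_resolventSet hμ₀).resolve_left
    (not_hasEigenvalue_deflate hT hc hμ₀)

include hT in
/-- **The resolvent of `T` near an eigenvalue through the deflated operator**: for `μ ≠ μ₀` in the
resolvent set of `S = T - μ₀P`, `μ` is in the resolvent set of `T` and
`R_T(μ) = R_S(μ)(1 - P) + (μ - μ₀)⁻¹ P`. [folklore] -/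
theorem mem_resolventSet_and_resolvent_eq {μ : ℂ} (hμS : μ ∈ resolventSet ℂ (deflate hc hμ₀)) (hne : μ ≠ μ₀) :
    μ ∈ resolventSet ℂ T ∧
      resolvent T μ = resolvent (deflate hc hμ₀) μ * (1 - eigenProj hc hμ₀) + (μ - μ₀)⁻¹ • eigenProj hc hμ₀ := by
  have hsub : μ - μ₀ ≠ 0 := sub_ne_zero.mpr hne
  -- basic identities, then generalise `P`, `S`
  have hPP : ∀ x, eigenProj hc hμ₀ (eigenProj hc hμ₀ x) = eigenProj hc hμ₀ x := eigenProj_idem hc hμ₀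
  have hTP : ∀ x, T (eigenProj hc hμ₀ x) = μ₀ • eigenProj hc hμ₀ x := apply_eigenProj hc hμ₀
  have hPT : ∀ x, eigenProj hc hμ₀ (T x) = T (eigenProj hc hμ₀ x) := eigenProj_apply_comm hT hc hμ₀
  have hTS : ∀ x, T x = deflate hc hμ₀ x + μ₀ • eigenProj hc hμ₀ x := apply_eq_deflate_add hc hμ₀
  have hPS : ∀ x, eigenProj hc hμ₀ (deflate hc hμ₀ x) = deflate hc hμ₀ (eigenProj hc hμ₀ x) :=
    eigenProj_deflate_comm hT hc hμ₀
  have hSP : ∀ x, deflate hc hμ₀ (eigenProj hc hμ₀ x) = 0 := deflate_eigenProj hc hμ₀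
  generalize eigenProj hc hμ₀ = P at *
  generalize deflate hc hμ₀ = S at *
  -- `P` commutes with `R_S(μ)`
  have hPRS : ∀ x, P (resolvent S μ x) = resolvent S μ (P x) := by
    intro x
    have h1 : μ • P (resolvent S μ x) - S (P (resolvent S μ x)) = P x := by
      rw [← hPS, ← map_smul, ← map_sub, sub_apply_resolvent hμS]
    exact eq_resolvent_of_sub_eq hμS h1
  have hRapply : ∀ x, (resolvent S μ * (1 - P) + (μ - μ₀)⁻¹ • P) x =
      resolvent S μ (x - P x) + (μ - μ₀)⁻¹ • P x := fun x => by
    simp [mul_apply_eq_comp]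
  -- right inverse
  have h₁ : (algebraMap ℂ (E →L[ℂ] E) μ - T) * (resolvent S μ * (1 - P) + (μ - μ₀)⁻¹ • P) = 1 := by
    ext x
    rw [mul_apply_eq_comp, one_apply_eq_self, algebraMap_sub_apply, hRapply]
    have hy : P (x - P x) = 0 := by rw [map_sub, hPP, sub_self]
    have e1 : μ • resolvent S μ (x - P x) - S (resolvent S μ (x - P x)) = x - P x := sub_apply_resolvent hμS _
    have e2 : T (resolvent S μ (x - P x)) = S (resolvent S μ (x - P x)) := by
      rw [hTS, hPRS, hy, map_zero, smul_zero, add_zero]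
    calc μ • (resolvent S μ (x - P x) + (μ - μ₀)⁻¹ • P x) - T (resolvent S μ (x - P x) + (μ - μ₀)⁻¹ • P x)
        = (μ • resolvent S μ (x - P x) - S (resolvent S μ (x - P x))) + ((μ - μ₀)⁻¹ * (μ - μ₀)) • P x := by
          rw [map_add, map_smul, e2, hTP]; module
      _ = x := by rw [e1, inv_mul_cancel₀ hsub, one_smul, sub_add_cancel]
  -- left inverse
  have h₂ : (resolvent S μ * (1 - P) + (μ - μ₀)⁻¹ • P) * (algebraMap ℂ (E →L[ℂ] E) μ - T) = 1 := by
    ext x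
    rw [mul_apply_eq_comp, one_apply_eq_self, algebraMap_sub_apply, hRapply]
    have hPz : P (μ • x - T x) = (μ - μ₀) • P x := by rw [map_sub, map_smul, hPT, hTP, sub_smul]
    have hz : μ • x - T x - P (μ • x - T x) = μ • (x - P x) - S (x - P x) := by
      rw [hPz, map_sub, hSP, sub_zero, hTS x]; module
    rw [hz, resolvent_apply_sub hμS, hPz, smul_smul, inv_mul_cancel₀ hsub, one_smul, sub_add_cancel]
  exact mem_resolventSet_and_resolvent_eq_of_inverse h₁ h₂

include hT hc hμ₀ in
/-- **Non-zero points of `ℂ` have a punctured neighbourhood in the resolvent set** of a compact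
self-adjoint operator (the non-zero spectrum is discrete). [folklore] -/
theorem eventually_mem_resolventSet : ∀ᶠ μ in 𝓝[≠] μ₀, μ ∈ resolventSet ℂ T := by
  have hopen : IsOpen (resolventSet ℂ (deflate hc hμ₀)) := spectrum.isOpen_resolventSet _
  have hmem := mem_resolventSet_deflate hT hc hμ₀
  have h1 : ∀ᶠ μ in 𝓝 μ₀, μ ∈ resolventSet ℂ (deflate hc hμ₀) := hopen.mem_nhds hmem
  have h2 : ∀ᶠ μ in 𝓝[≠] μ₀, μ ≠ μ₀ := eventually_nhdsWithin_of_forall fun μ hμ => hμ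
  filter_upwards [nhdsWithin_le_nhds h1, h2] with μ hμ hne
  exact (mem_resolventSet_and_resolvent_eq hT hc hμ₀ hμ hne).1

include hT hc hμ₀ in
/-- **The resolvent of a compact self-adjoint operator is meromorphic at every `μ₀ ≠ 0`**
(operator-valued; at most a simple pole, with residue the eigenprojection). [folklore] -/
theorem meromorphicAt_resolvent : MeromorphicAt (resolvent T) μ₀ := by
  have hopen : IsOpen (resolventSet ℂ (deflate hc hμ₀)) := spectrum.isOpen_resolventSet _
  have hmem := mem_resolventSet_deflate hT hc hμ₀
  have hRS : AnalyticAt ℂ (resolvent (deflate hc hμ₀)) μ₀ := analyticOnNhd_resolvent μ₀ hmem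
  -- `G(μ) = R_S(μ)(1 - P) + (μ - μ₀)⁻¹ P` is meromorphic at `μ₀` and agrees with `R_T` nearby
  have hG : MeromorphicAt (fun μ : ℂ =>
      resolvent (deflate hc hμ₀) μ * (1 - eigenProj hc hμ₀) + (μ - μ₀)⁻¹ • eigenProj hc hμ₀) μ₀ := by
    have h1 : MeromorphicAt (fun μ => resolvent (deflate hc hμ₀) μ * (1 - eigenProj hc hμ₀)) μ₀ :=
      (hRS.mul analyticAt_const).meromorphicAt
    have h2 : MeromorphicAt (fun μ : ℂ => (μ - μ₀)⁻¹) μ₀ :=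
      ((analyticAt_id.sub analyticAt_const).meromorphicAt).inv
    exact h1.add (h2.smul (MeromorphicAt.const (eigenProj hc hμ₀) μ₀))
  refine hG.congr ?_
  have h1 : ∀ᶠ μ in 𝓝 μ₀, μ ∈ resolventSet ℂ (deflate hc hμ₀) := hopen.mem_nhds hmem
  have h2 : ∀ᶠ μ in 𝓝[≠] μ₀, μ ≠ μ₀ := eventually_nhdsWithin_of_forall fun μ hμ => hμ
  filter_upwards [nhdsWithin_le_nhds h1, h2] with μ hμ hne
  exact (mem_resolventSet_and_resolvent_eq hT hc hμ₀ hμ hne).2.symm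

end Compact

/-! ## 4. Meromorphic families `s ↦ R(c(s)) a(s)` -/

section Families

variable [CompleteSpace E] {T : E →L[ℂ] E}

/-- **Applying an operator-valued meromorphic function to an analytic vector-valued one is
meromorphic.** [folklore] -/
theorem _root_.MeromorphicAt.clm_apply_analyticAt {G : ℂ → (E →L[ℂ] E)} {a : ℂ → E} {s : ℂ}
    (hG : MeromorphicAt G s) (ha : AnalyticAt ℂ a s) : MeromorphicAt (fun z => G z (a z)) s := by
  obtain ⟨n, hn⟩ := hG
  refine ⟨n, (hn.clm_apply_analyticAt ha).congr (Eventually.of_forall fun z => ?_)⟩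
  simp

/-- Vector form of the meromorphy of the resolvent: `μ ↦ R(μ) x`. [folklore] -/
theorem meromorphicAt_resolvent_apply (hT : IsSelfAdjoint T) (hc : IsCompactOperator T) {μ₀ : ℂ} (hμ₀ : μ₀ ≠ 0)
    (x : E) : MeromorphicAt (fun μ => resolvent T μ x) μ₀ :=
  (meromorphicAt_resolvent hT hc hμ₀).clm_apply_analyticAt analyticAt_const

/-- **The family `s ↦ R_T(c(s)) a(s)` is meromorphic** at every point where the analytic scalar
function `c` does not vanish, for a compact self-adjoint `T` and an analytic vector-valued `a`.
[folklore] -/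
theorem meromorphicAt_resolvent_comp (hT : IsSelfAdjoint T) (hc : IsCompactOperator T) {c : ℂ → ℂ}
    {a : ℂ → E} {s : ℂ} (hca : AnalyticAt ℂ c s) (hc0 : c s ≠ 0) (ha : AnalyticAt ℂ a s) :
    MeromorphicAt (fun z => resolvent T (c z) (a z)) s := by
  have h1 : MeromorphicAt (resolvent T ∘ c) s := (meromorphicAt_resolvent hT hc hc0).comp_analyticAt hca
  exact h1.clm_apply_analyticAt ha

end Families


/-! ## 5. The identity principle for meromorphic vector-valued functions -/

section Identity

variable {V : Type*} [NormedAddCommGroup V] [NormedSpace ℂ V]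

/-- **Identity principle for meromorphic functions on a connected set**: if `f` is meromorphic on a
preconnected `U` and vanishes on a punctured neighbourhood of one point of `U`, then it vanishes on
a punctured neighbourhood of every point of `U`. [folklore] -/
theorem _root_.MeromorphicOn.eventually_eq_zero_of_eventually_eq_zero {f : ℂ → V} {U : Set ℂ}
    (hf : MeromorphicOn f U) (hU : IsPreconnected U) {z₀ : ℂ} (hz₀ : z₀ ∈ U)
    (h : ∀ᶠ z in 𝓝[≠] z₀, f z = 0) {z : ℂ} (hz : z ∈ U) : ∀ᶠ w in 𝓝[≠] z, f w = 0 := by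
  rw [← meromorphicOrderAt_eq_top_iff] at h ⊢
  by_contra hne
  exact (hf.meromorphicOrderAt_ne_top_of_isPreconnected hU hz hz₀ hne) h

/-- … and it vanishes AT every point where it is continuous (e.g. analytic). [folklore] -/
theorem _root_.MeromorphicOn.eq_zero_of_eventually_eq_zero {f : ℂ → V} {U : Set ℂ}
    (hf : MeromorphicOn f U) (hU : IsPreconnected U) {z₀ : ℂ} (hz₀ : z₀ ∈ U)
    (h : ∀ᶠ z in 𝓝[≠] z₀, f z = 0) {z : ℂ} (hz : z ∈ U) (hcont : ContinuousAt f z) : f z = 0 := by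
  have hev := hf.eventually_eq_zero_of_eventually_eq_zero hU hz₀ h hz
  have h1 : Tendsto f (𝓝[≠] z) (𝓝 (f z)) := hcont.tendsto.mono_left nhdsWithin_le_nhds
  have h2 : Tendsto f (𝓝[≠] z) (𝓝 0) := tendsto_const_nhds.congr' (hev.mono fun w hw => hw.symm)
  exact tendsto_nhds_unique h1 h2

/-- **Two meromorphic functions on a connected open set which agree near one point agree at every
point where both are continuous.** [folklore] -/
theorem _root_.MeromorphicOn.eq_of_eventually_eq {f g : ℂ → V} {U : Set ℂ}
    (hf : MeromorphicOn f U) (hg : MeromorphicOn g U) (hU : IsPreconnected U) {z₀ : ℂ} (hz₀ : z₀ ∈ U)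
    (h : ∀ᶠ z in 𝓝[≠] z₀, f z = g z) {z : ℂ} (hz : z ∈ U) (hfc : ContinuousAt f z) (hgc : ContinuousAt g z) :
    f z = g z := by
  have hfg : MeromorphicOn (f - g) U := hf.sub hg
  have h0 : ∀ᶠ z in 𝓝[≠] z₀, (f - g) z = 0 := h.mono fun w hw => by simp [hw]
  have := hfg.eq_zero_of_eventually_eq_zero hU hz₀ h0 hz (hfc.sub hgc)
  simpa [sub_eq_zero] using this

/-- Punctured form: they agree on a punctured neighbourhood of every point. [folklore] -/
theorem _root_.MeromorphicOn.eventually_eq_of_eventually_eq {f g : ℂ → V} {U : Set ℂ}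
    (hf : MeromorphicOn f U) (hg : MeromorphicOn g U) (hU : IsPreconnected U) {z₀ : ℂ} (hz₀ : z₀ ∈ U)
    (h : ∀ᶠ z in 𝓝[≠] z₀, f z = g z) {z : ℂ} (hz : z ∈ U) : ∀ᶠ w in 𝓝[≠] z, f w = g w := by
  have hfg : MeromorphicOn (f - g) U := hf.sub hg
  have h0 : ∀ᶠ z in 𝓝[≠] z₀, (f - g) z = 0 := h.mono fun w hw => by simp [hw]
  filter_upwards [hfg.eventually_eq_zero_of_eventually_eq_zero hU hz₀ h0 hz] with w hw
  simpa [sub_eq_zero] using hw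

omit [NormedAddCommGroup V] [NormedSpace ℂ V] in
/-- An eventual equality on a full neighbourhood gives one on the punctured neighbourhood. [folklore] -/
theorem _root_.Filter.EventuallyEq.nhdsNE_of_nhds {V : Type*} {f g : ℂ → V} {z₀ : ℂ} (h : f =ᶠ[𝓝 z₀] g) :
    ∀ᶠ z in 𝓝[≠] z₀, f z = g z :=
  h.filter_mono nhdsWithin_le_nhds

end Identity

end CompactResolvent

end Literature.Analysis.OperatorTheory
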